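import Summits.BirchSwinnertonDyer.BirchSwinnertonDyer.Theorems.ByReductionTypeAtTwoAdditivePotGoodPrintZhaiIrreducibleUnramified
import HarnessLib

/-!
# K4 crux `AdditiveRankZeroAtTwo` (19098), child C3″ `AdditivePotGoodLowerHalfAtTwo` (22617): the ZHAI 2016 print road is NOT VACUOUS at
# the off-window base `44A1` — the member `44A1^{(−3)}` (`a₃(44A1) = 1` odd ⇒ `3` inert in the cubic `2`-division field)

Cell `bsd-2adic`, seat `bsd-2adic-k4-w2` GEN 6 (prover, explicit unit, no kit); `--supports stmt-BirchSwinnertonDyer-22617 --as helper`;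
companion of `…PrintZhaiIrreducibleUnramified.lean`. HONEST FRAMING (D-0036/D-0054): for each base `V` the KERNEL certifies one member
`M = q*` of Zhai's family — `a_q(V)` odd (certified point count `#Ẽ(𝔽_q)` ⇒ `q` inert in the cubic `2`-division field, U2's dictionary
`isInertIn_of_odd_frobeniusTrace`), `M ≡ 1 (mod 4)` square-free, `(q, N) = 1` from `N ∣ |Δ_min|` — and the base file's road gives, at every
global minimal `W ≅ V^{(M)}`: `r_an(W) = 0`, `Addv W 2`, `0 ≤ ord₂ j`, `¬CM`, `Irr W 2` and the LOWER half `MissingLowerBoundAt W 2`.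
Displayed, exactly as printed: the optimality datum (`Dt`, `hopt`) and the record `ord₂(L(V,1)/Ω_∞(V))`; by name: Zhai 2016 Thm. 1.1/1.2
(corrected, arXiv v2), Agashe–Ribet–Stein Thm. 2.6, modularity. Closes nothing at the `∀`-level; nothing booked; BSD is not proved by any of this.
References: [Zhai2016] Thms. 1.1–1.2; [SilvermanAEC2009] V.2, III.2.3; [Miller2011LMS] Def. 1.1.
-/

set_option autoImplicit false
-- the Theorems namespace of this sub repeats the summit name by design (D-0017 nested layout)
set_option linter.dupNamespace false

noncomputable section

open scoped Classical

open WeierstrassCurve Literature.NumberTheory.EllipticCurves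
  Literature.NumberTheory.EllipticCurves.ModularForms
  Literature.NumberTheory.EllipticCurves.Rank1Residual
  Literature.NumberTheory.EllipticCurves.Rank1Residual.Typed
  Literature.NumberTheory.EllipticCurves.CoatesLiTianZhai2015
  Literature.NumberTheory.EllipticCurves.Zhai2016
  Literature.NumberTheory.EllipticCurves.AgasheRibetStein2006
  Summit.BirchSwinnertonDyer
  Summit.BirchSwinnertonDyer.Rank1Residual
  Summit.BirchSwinnertonDyer.Rank1Residual.X11b
  Summit.BirchSwinnertonDyer.Rank1Residual.X5.O1
  Summit.BirchSwinnertonDyer.Rank1Residual.P2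
  Summit.BirchSwinnertonDyer.BirchSwinnertonDyer.Rank1Residual.IntModel
  Summit.BirchSwinnertonDyer.BirchSwinnertonDyer.Theorems

namespace Summit.BirchSwinnertonDyer.BirchSwinnertonDyer.Theorems.AddPotGoodPrint

/-! ## Witness member `44A1^{(-3)}`: `a_3(44A1) = 1` odd ⇒ `3` inert in the cubic `2`-division field; `M = 3* = -3 ≡ 1 (mod 4)` -/
section Witness44A1

/-- **`#Ẽ(𝔽_3) = 3` for `44A1`** (certified count `countPoints`, `decide +kernel`; `3 ∤ Δ = -2816`). [cite: SilvermanAEC2009, V.2] -/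
theorem reductionPointCount_3_44A1 [(⟨0, 1, 0, 3, -1⟩ : WeierstrassCurve ℚ).IsGloballyMinimal] :
    (⟨0, 1, 0, 3, -1⟩ : WeierstrassCurve ℚ).reductionPointCount 3 = 3 := by
  haveI : Fact (Nat.Prime 3) := ⟨by norm_num⟩
  haveI := isElliptic_44A1
  exact Supersingular.reductionPointCount_eq_of_intModel_countPoints intModel_44A1 3 (by norm_num) (by decide +kernel)
    (by decide +kernel)

/-- **`a_3(44A1) = 1` is odd**: `Frob_3` is a `3`-cycle on `E[2] ∖ {0}`, i.e. `3` is inert in the cubic `2`-division field of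
`44A1` (Zhai's twisting condition). [cite: Zhai2016, Thm. 1.1 (hypothesis "inert in F")] -/
theorem odd_frobeniusTrace_3_44A1 [(⟨0, 1, 0, 3, -1⟩ : WeierstrassCurve ℚ).IsGloballyMinimal] :
    Odd ((⟨0, 1, 0, 3, -1⟩ : WeierstrassCurve ℚ).frobeniusTrace 3) := by
  rw [Uniform.U2.odd_frobeniusTrace_iff_odd_reductionPointCount _ (by norm_num : Nat.Prime 3) (by norm_num),
    reductionPointCount_3_44A1]
  decide

/-- **C3″'s conclusion at every global minimal model of `44A1^{(-3)}`** — the member `M = 3* = -3` of the Zhai-1.1 family of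
`44A1` (`-3 ≡ 1 (mod 4)` square-free, `(3, N) = 1` since `N ∣ |Δ| = 2816`, `3` inert in the cubic `2`-division field because
`a_3 = 1` is odd — ALL IN THE KERNEL; `F` exists by `U2.exists_isTwoDivisionField`). Displayed: the optimality datum and the record
`ord₂(L(44A1,1)/Ω_∞) = 0`; by name: Zhai Thm. 1.1 (corrected), ARS Thm. 2.6, modularity. The `44A1` road is not vacuous.
BSD is not proved by any of this. [cite: Zhai2016, Thm. 1.1] [cite: AgasheRibetStein2006, Thm. 2.6] [cite: Miller2011LMS, Def. 1.1] -/
theorem printFamily44A1_witness_neg3 (h11 : thm11_ordTwo_LAlg_twist_eq_zero')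
    (h26 : cremona_abs_maninConstant_eq_one_of_level_le) (hmod : hasEntireLFunction_rat)
    [hN : haveI := isElliptic_44A1; NeZero ((⟨0, 1, 0, 3, -1⟩ : WeierstrassCurve ℚ).conductorNorm ℤ)]
    (Dt : haveI := isElliptic_44A1; ModularParametrizationData (⟨0, 1, 0, 3, -1⟩ : WeierstrassCurve ℚ) ((⟨0, 1, 0, 3, -1⟩ : WeierstrassCurve ℚ).conductorNorm ℤ))
    (hopt : haveI := isElliptic_44A1; Zhai2021.IsOptimalDatum (⟨0, 1, 0, 3, -1⟩ : WeierstrassCurve ℚ) Dt)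
    (hL : haveI := isElliptic_44A1; ∃ x : ℚ, IsLAlg (⟨0, 1, 0, 3, -1⟩ : WeierstrassCurve ℚ) x ∧ x ≠ 0 ∧ padicValRat 2 x = 0)
    (W : WeierstrassCurve ℚ) [W.IsElliptic] [W.IsGloballyMinimal]
    (hW : ∃ C : VariableChange ℚ, C • (⟨0, 1, 0, 3, -1⟩ : WeierstrassCurve ℚ).quadraticTwist ((-3 : ℤ) : ℚ) = W) :
    haveI : Fact (Nat.Prime 2) := ⟨Nat.prime_two⟩
    W.analyticRank = 0 ∧ Addv W 2 ∧ 0 ≤ padicValRat 2 W.j ∧ ¬ W.HasCM ∧ Irr W 2 ∧ MissingLowerBoundAt W 2 := by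
  haveI : Fact (Nat.Prime 2) := ⟨Nat.prime_two⟩
  haveI := isElliptic_44A1; haveI := isGloballyMinimal_44A1
  have hq : Nat.Prime 3 := by norm_num
  obtain ⟨F, _, _, hF⟩ := Uniform.U2.exists_isTwoDivisionField (⟨0, 1, 0, 3, -1⟩ : WeierstrassCurve ℚ)
    ((X5.O1.irr_two_iff_forall_two_nsmul _).mp irr_two_44A1)
  have hgood : ¬ ((3 : ℕ) : ℤ) ∣ minimalDiscriminantInt (⟨0, 1, 0, 3, -1⟩ : WeierstrassCurve ℚ) := by
    rw [minimalDiscriminantInt_eq intModel_44A1, M44A1_Δ]; decide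
  have hin : IsInertIn F 3 :=
    Uniform.U2.isInertIn_of_odd_frobeniusTrace _ hF hq (by norm_num) hgood odd_frobeniusTrace_3_44A1
  have hna : (-3 : ℤ).natAbs = 3 := rfl
  have hgcd : Int.gcd (-3 : ℤ) ((⟨0, 1, 0, 3, -1⟩ : WeierstrassCurve ℚ).conductorNorm ℤ) = 1 := by
    have h' : Nat.Coprime 3 ((⟨0, 1, 0, 3, -1⟩ : WeierstrassCurve ℚ).conductorNorm ℤ) :=
      Nat.Coprime.coprime_dvd_right conductorNorm_dvd_44A1 (by norm_num)
    rw [Int.gcd, hna, Int.natAbs_natCast]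
    exact h'
  refine printFamily44A1_lower h11 h26 hmod Dt hopt hL F hF (-3 : ℤ) ?_ (by decide) hgcd ?_ ?_ W hW
  · rw [← Int.squarefree_natAbs, hna]; exact hq.prime.squarefree
  · exact ⟨3, by rw [hna, Nat.Prime.primeFactors hq]; simp⟩
  · intro p hp
    rw [hna, Nat.Prime.primeFactors hq, Finset.mem_singleton] at hp
    subst hp
    exact ⟨by norm_num, hin⟩

end Witness44A1

end Summit.BirchSwinnertonDyer.BirchSwinnertonDyer.Theorems.AddPotGoodPrint

end
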